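import Summits.QuantumFields.YangMills.Theorems.BalabanUVNodesK2D1StubJetsFree
import Literature.MathematicalPhysics.QuantumFieldTheory.Balaban1983to89.Beta.DriftRemainder
import Literature.MathematicalPhysics.QuantumFieldTheory.Balaban1983to89.Node00.Record13NumericsOfThm1CC1

/-!
# DAG node N26 ∕ row (D4) — THE β-BOX `(U)` ∕ `(LOW)` AT THE STAGE-13 β OF RECORD IS THE K2 PAIR's COROLLARY: `BetaUpperH (d + 2A + s) γ₀ (betaOfRecord₁₃ F N θ)` and
# `BetaLowerH (d − 2A − s) γ₀ (betaOfRecord₁₃ F N θ)` from the (D1) drift letters `(d, A)` of the record's one-loop numbers and the rows-(D4) ∧ B4 residue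
# `AtSlopeCont (split₁₃ θ) γ₀ s` — record-generic, from a pinned (D1) datum, from the REGISTERED pair, and at NODE 00's C¹ witness `θ₁₅ᶜᶜ¹` on the box `½`

BINDER row (D4) OWNER lineage `b2b-balaban-beta-an4` (gen 134), cell `pub-balaban`; helper for crux K2⁗ `EndpointGivenBR13Sep` (stmt-QuantumFields-20291; skeleton
`K2Skeleton13Sep.lean` f65d6d28…, stubs `stub_d1Residue13 : D1AtRecord13`, `stub_d4AtSlopeCont13 : D4AtSlopeOfD1Record13`).

WHY THIS FILE.  The printed-type UPPER BOUND `FlowStep.BetaUpperH β′ γ₀ β` («uniformly bounded on this interval», [I] p. 264; the tree's docstring: «derivable from (5.10) +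
(5.42)») is DISPLAYED as a hypothesis `hhi ∕ hup` at the Stage-13 β of record by the K1 ∕ K2 ∕ K0 lanes (N12 `…N12AtRecord13WitnessFamily` ∕ `…SepSockets` ∕ `…TermPin`, N10
`…N10XPinnedClosers13`, K2 `…K2AtRecord13CoreTopRuns.endpointExistence_datumOfRecord₁₃Core_iff_topRuns (hhi)`, `…K2AtBetaOfRecord13ChainFree`, and — pub-ymgap bus
2026-08-27T08:40Z, node00-def-K0a g7 FILE 14d `Node00/Record13ReverseComparabilityOfBetaBox` (p516445) — the K0 lane's β-BOX leaf `BetaLowerH b ½ β₁₃ ∧ BetaUpperH β′ ½ β₁₃`, `β′ ≤ 3`, at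
`θ₁₅ᶜᶜ¹`, «the (D4) lane's printed uniformly bounded»).  On row (D4)'s road it is NOT an independent leaf: the row-(D4) owner's `Beta.DriftRemainder.betaUpperH_of_drift_remainderConst`
(drift of the one-loop numbers + the constant-form remainder) and `Gaps.BetaContFromD4Chain.remainderConst_of_atSlopeCont` (the registered stub-2 currency ⟹ the constant form) compose
to `(U)` with the constant COMPUTED, `β′ := d + 2A + s`; the same letters give the pointwise lower companion `b := d − 2A − s` (contentful only when `d > 2A + s`; the SIGN ∕
asymptotic-freedom input `BetaLowerH b` with `b ≥ 0` is NOT claimed — T09.F).  This file states that junction BY NAME at the Stage-13 β of record, so that every consumer's `hhi ∕ hup`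
at `betaOfRecord₁₃ F N θ` (datum faces `(datumOfRecord₁₃… θ h).βfun` are `rfl`) is fed by the two registered K2 stub BODIES at θ — jets-free: «`β⁰_θ` drifts with slope `d ≥ 0`, defect
`A`» ∧ «`AtSlopeCont (split₁₃ θ) γ₀ s`» (dag-n26-c `…K2D1StubJetsFree.registeredPair₁₃_iff_jetsFreePair`).

WHAT IS HERE (0 `def`, 0 `sorry`; compositions BY NAME; general `N`, the stubs' `N = 2` an instance).
§0 generic (`β : HBeta`, any split): `betaUpperH_of_drift_atSlopeCont` (`BetaUpperH (d + 2A + s) γ₀ β`), `betaLowerH_of_drift_remainderConst` ∕ `betaLowerH_of_drift_atSlopeCont`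
(`BetaLowerH (d − 2A − s) γ₀ β`), `betaBox_of_drift_atSlopeCont` (both, monotone in the two constants).
§1 at the Stage-13 β of record `betaOfRecord₁₃ F N θ` (θ : `Stage13Params F N` arbitrary; the split is the merged split `split₁₃ θ` of the registered stub — every split of the ₁₃ β is it,
`…N26AtRecord13.oneLoopSplit_betaOfRecord₁₃_eq`): ★ `betaBox_betaOfRecord₁₃_of_drift_atSlopeCont` (drift `(d, A)` of `β⁰_θ` + `AtSlopeCont (split₁₃ θ) γ₀ s` ⟹ the β-box with
`b ≤ d − 2A − s`, `d + 2A + s ≤ β′`); `exists_betaUpperH_betaOfRecord₁₃_of_pin_residue_atSlopeCont` (a PINNED (D1) datum `(Lc, Js, Nc)` with its residue — stub 1's body at θ — +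
`AtSlopeCont` at slope `s` ⟹ `∃ A ≥ 0, BetaUpperH (stepBal Nc Lc + 2A + s) γ₀ (betaOfRecord₁₃ F N θ)`); ★ `exists_betaBox_betaOfRecord₁₃_of_jetsFreePair` ∕
`exists_betaBox_betaOfRecord₁₃_of_registeredPair` (the jets-free pair, resp. THE TWO REGISTERED STUB BODIES AT θ VERBATIM, ⟹ `∃ γ₀ ∈ ]0, θ.γ], ∃ β′ ≥ 0, BetaUpperH β′ γ₀ (betaOfRecord₁₃ F N θ) ∧
BetaLowerH (−β′) γ₀ (betaOfRecord₁₃ F N θ) ∧ BetaContH γ₀ (betaOfRecord₁₃ F N θ)` — (U), a two-sided bound and B4 on ONE box, from K2⁗'s pair alone).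
§2 at NODE 00's C¹ witness `θ₁₅ᶜᶜ¹ = theta13OfThm1CC1 F N ε₀ ε₂₉ B₃ B₃' a₀ a₁` ON THE BOX `½ = θ₁₅ᶜᶜ¹.γ` (K0a `theta13OfThm1CC1_γ`, `rfl`): ★ `betaBox_half_theta13OfThm1CC1_of_drift_atSlopeCont`
— K0a FILE 14d's two binders `(hlow : BetaLowerH b (1∕2) (betaOfRecord₁₃ F N θ₁₅ᶜᶜ¹)) (hup : BetaUpperH β' (1∕2) (betaOfRecord₁₃ F N θ₁₅ᶜᶜ¹))` from the drift letters of `β⁰(θ₁₅ᶜᶜ¹)` and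
`AtSlopeCont (split₁₃ θ₁₅ᶜᶜ¹) (1∕2) s`, under the two numeric side conditions `b ≤ d − 2A − s`, `d + 2A + s ≤ β′` (their `β′ ≤ 3` is then the (D1)-letters inequality `d + 2A + s ≤ 3`).
The OBJECTS face (AtSlopeCont at the displayed box and a free slope below a threshold along the live witness family, NODE D supplied) is the companion module
`…N26AtTheta13LiveAtSlopeBelowBetaBoxTowerFlat`.

HONEST FRAMING.  Elementary compositions (two `linarith` lines over the split `β = β⁰ + β¹`); every drift ∕ residue ∕ `AtSlopeCont` input is a DISPLAYED hypothesis — the bodies of the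
two registered stubs at θ, themselves NOT proved ((D4) INSTANCE 0∕1 at every record and witness family: the record's `β⁰_θ`, `β_θ` are `limUnder` objects of NODE O; critical-path width
0 = NODE O; D4 DISCHARGE NO DATE); `(U)` is NOT discharged at the record, only REDUCED to the K2 pair; the sign `BetaLowerH b`, `b ≥ 0`, is NOT claimed; K2⁗ NOT proved; N26 ∕ N24 NOT
discharged; counts unmoved; count-neutral.  One finite four-torus programme at fixed ε per run — NOT the continuum limit, NOT ℝ⁴, NOT OS, NOT a mass gap, NOT Clay.  No `instance`, no
`notation`, no `axiom`.
Sources (context): [I] = [Balaban1987RG1] CMP **109** (1987): Thm 2 p. 259, §1 p. 264 ((1.20)–(1.22), «uniformly bounded»), (2.12)–(2.14) p. 268, (5.10) p. 293; [II] =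
[Balaban1988RG2Cluster] CMP **116** (1988): Lemma 3 (2.38) p. 20, (2.41) p. 21; [III] = [Balaban1988Convergent] CMP **119** (1988): (2.6)–(2.9) p. 255–256.
-/

noncomputable section

open scoped Matrix.Norms.L2Operator

namespace Summit.QuantumFields.YangMills.Theorems.BalabanUVNodesN26AtRecord13BetaBoxOfDriftAtSlope

open Literature.MathematicalPhysics.QuantumFieldTheory.Balaban1983to89
open Literature.MathematicalPhysics.QuantumFieldTheory.Balaban1983to89.FlowStep
open Literature.MathematicalPhysics.QuantumFieldTheory.Balaban1983to89.T4Continuum (T4Family)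
open Literature.MathematicalPhysics.QuantumFieldTheory.Balaban1983to89.Node00
open Literature.MathematicalPhysics.QuantumFieldTheory.Balaban1983to89.B12Beta (secondMoment)
open Literature.MathematicalPhysics.QuantumFieldTheory.Balaban1983to89.Beta.Drift (OneLoopDrift)
open Literature.MathematicalPhysics.QuantumFieldTheory.Balaban1983to89.Beta.RemainderChain (RemainderConst)
open Literature.MathematicalPhysics.QuantumFieldTheory.Balaban1983to89.Beta.DriftRemainder
  (betaUpperH_of_drift_remainderConst abs_beta0_sub_le_of_drift remainderConst_nonneg)
open Literature.MathematicalPhysics.QuantumFieldTheory.Balaban1983to89.FlowStepRuns (histBox_of_mem_box)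
open Literature.MathematicalPhysics.QuantumFieldTheory.Balaban1983to89.Beta.OneStepResolventKernel (JetData)
open Literature.MathematicalPhysics.QuantumFieldTheory.Balaban1983to89.Beta.OneStepKernelFamily (TbalOf)
open Summit.QuantumFields.BalabanUV.Gaps
open Summit.QuantumFields.BalabanUV.Gaps.BetaContFromD4Chain (AtSlopeCont remainderConst_of_atSlopeCont betaContH_of_atSlopeCont)
open Summit.QuantumFields.BalabanUV.Gaps.D1Residue (Residue d1Drift_of_residue)
open Summit.QuantumFields.YangMills.Theorems.BalabanUVNodesK2D1StubJetsFree (registeredPair₁₃_iff_jetsFreePair)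

/-! ## §0 Generic: the β-box of a split HBeta from the drift of its one-loop field and the `AtSlopeCont` residue -/

section Generic

variable {β : HBeta}

/-- **(U) FROM DRIFT + THE REGISTERED RESIDUE CURRENCY**: `OneLoopDrift d A Sβ.β0` and `AtSlopeCont Sβ γ₀ s` give `BetaUpperH (d + 2A + s) γ₀ β` — row an4's
`betaUpperH_of_drift_remainderConst` after `remainderConst_of_atSlopeCont` (`|β¹| ≤ ε₁·K_rem,L ≤ s` on the box). [cite: Balaban1987RG1, §1 p.264 and (5.10) p.293; Balaban1988RG2Cluster, (2.41) p.21] -/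
theorem betaUpperH_of_drift_atSlopeCont (Sβ : B12Beta.OneLoopSplit β) {d A γ₀ s : ℝ} (hdrift : OneLoopDrift d A Sβ.β0)
    (hres : AtSlopeCont Sβ γ₀ s) : BetaUpperH (d + 2 * A + s) γ₀ β :=
  betaUpperH_of_drift_remainderConst Sβ hdrift (remainderConst_of_atSlopeCont hres)

/-- **The pointwise LOWER companion from the same letters**: `OneLoopDrift d A Sβ.β0` (so `|β⁰_k − d| ≤ 2A`, `abs_beta0_sub_le_of_drift`) and `RemainderConst Sβ γ r` give
`BetaLowerH (d − 2A − r) γ β`.  Contentful only when `d > 2A + r`; NOT the sign input `BetaLowerH b`, `b ≥ 0` (T09.F, unprinted). [cite: Balaban1987RG1, (2.12)–(2.14) p.268 and §1 p.264] -/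
theorem betaLowerH_of_drift_remainderConst (Sβ : B12Beta.OneLoopSplit β) {d A γ r : ℝ} (hdrift : OneLoopDrift d A Sβ.β0)
    (hrem : RemainderConst Sβ γ r) : BetaLowerH (d - 2 * A - r) γ β := by
  intro k v hv
  have h1 := (abs_le.mp (hrem k v (histBox_of_mem_box hv))).1
  have h0 := (abs_le.mp (abs_beta0_sub_le_of_drift hdrift k)).1
  rw [Sβ.split k]
  linarith

/-- … and from `AtSlopeCont Sβ γ₀ s`: `BetaLowerH (d − 2A − s) γ₀ β`. [cite: Balaban1987RG1, (2.12)–(2.14) p.268 and (5.10) p.293] -/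
theorem betaLowerH_of_drift_atSlopeCont (Sβ : B12Beta.OneLoopSplit β) {d A γ₀ s : ℝ} (hdrift : OneLoopDrift d A Sβ.β0)
    (hres : AtSlopeCont Sβ γ₀ s) : BetaLowerH (d - 2 * A - s) γ₀ β :=
  betaLowerH_of_drift_remainderConst Sβ hdrift (remainderConst_of_atSlopeCont hres)

/-- **THE β-BOX FROM DRIFT + `AtSlopeCont`, MONOTONE IN THE TWO CONSTANTS**: `b ≤ d − 2A − s` and `d + 2A + s ≤ β′` give `BetaLowerH b γ₀ β ∧ BetaUpperH β′ γ₀ β`.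
[cite: Balaban1987RG1, §1 p.264, (2.12)–(2.14) p.268 and (5.10) p.293] -/
theorem betaBox_of_drift_atSlopeCont (Sβ : B12Beta.OneLoopSplit β) {d A γ₀ s b β' : ℝ} (hdrift : OneLoopDrift d A Sβ.β0)
    (hres : AtSlopeCont Sβ γ₀ s) (hb : b ≤ d - 2 * A - s) (hβ' : d + 2 * A + s ≤ β') : BetaLowerH b γ₀ β ∧ BetaUpperH β' γ₀ β :=
  ⟨fun k v hv => hb.trans (betaLowerH_of_drift_atSlopeCont Sβ hdrift hres k v hv),
    fun k v hv => (betaUpperH_of_drift_atSlopeCont Sβ hdrift hres k v hv).trans hβ'⟩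

/-- The sign of the computed upper constant on a non-empty box: `0 < γ₀`, the drift, `AtSlopeCont Sβ γ₀ s` and `s ≤ d` give `0 ≤ d + 2A + s` (`upperConst_nonneg`'s shape).
[cite: Balaban1987RG1, §1 p.264] -/
theorem upperConst_nonneg_of_drift_atSlopeCont (Sβ : B12Beta.OneLoopSplit β) {d A γ₀ s : ℝ} (hγ₀ : 0 < γ₀) (hdrift : OneLoopDrift d A Sβ.β0)
    (hres : AtSlopeCont Sβ γ₀ s) (hsd : s ≤ d) : 0 ≤ d + 2 * A + s := by
  have hs0 := remainderConst_nonneg (remainderConst_of_atSlopeCont hres) hγ₀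
  linarith [hdrift.nonneg]

end Generic

variable (F : T4Family) (N : ℕ) [NeZero N]

/-! ## §1 At the Stage-13 β of record `betaOfRecord₁₃ F N θ` (θ arbitrary): the β-box from the K2 pair's letters ∕ bodies -/

section AtRecord

variable (θ : Stage13Params F N)

/-- **★ THE β-BOX AT THE STAGE-13 β OF RECORD FROM THE (D1) DRIFT LETTERS AND THE REGISTERED (D4) ∧ B4 RESIDUE**: `OneLoopDrift d A β⁰_θ` (`β⁰_θ = beta0OfMerged β_m θ.v₀`) and
`AtSlopeCont (split₁₃ θ) γ₀ s` give `BetaLowerH b γ₀ (betaOfRecord₁₃ F N θ) ∧ BetaUpperH β′ γ₀ (betaOfRecord₁₃ F N θ)` for every `b ≤ d − 2A − s`, `d + 2A + s ≤ β′` (§0 at the merged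
split; the ₁₃ β IS the split's β, `…N26AtRecord13.betaOfRecord₁₃_eq_betaT`, `rfl`).  Every K1 ∕ K2 ∕ K0 consumer's `hhi ∕ hup : BetaUpperH β′ γ₀ (betaOfRecord₁₃ F N θ)` is this `.2`.
Instance 0∕1. [cite: Balaban1987RG1, Thm 2 p.259, §1 p.264, (2.12)–(2.14) p.268 and (5.10) p.293; Balaban1988RG2Cluster, Lemma 3 (2.38) p.20 and (2.41) p.21] -/
theorem betaBox_betaOfRecord₁₃_of_drift_atSlopeCont {d A γ₀ s b β' : ℝ}
    (hdrift : letI := θ.instVβ₁; letI := θ.instVβ₂; letI := θ.instιβ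
      OneLoopDrift d A (beta0OfMerged (betaMerged F (mergedTermFamilyMatT F N (TcanOfRecord F N) (chiFixed29 F N θ.ν θ.ε₂₉) θ.εbg) θ.ρ8 θ.bV) θ.v₀))
    (hres : letI := θ.instVβ₁; letI := θ.instVβ₂; letI := θ.instιβ
      AtSlopeCont
        (oneLoopSplit_betaOfMerged (betaMerged F (mergedTermFamilyMatT F N (TcanOfRecord F N) (chiFixed29 F N θ.ν θ.ε₂₉) θ.εbg) θ.ρ8 θ.bV)
          (beta0OfMerged (betaMerged F (mergedTermFamilyMatT F N (TcanOfRecord F N) (chiFixed29 F N θ.ν θ.ε₂₉) θ.εbg) θ.ρ8 θ.bV) θ.v₀) θ.γ)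
        γ₀ s)
    (hb : b ≤ d - 2 * A - s) (hβ' : d + 2 * A + s ≤ β') :
    BetaLowerH b γ₀ (betaOfRecord₁₃ F N θ) ∧ BetaUpperH β' γ₀ (betaOfRecord₁₃ F N θ) :=
  betaBox_of_drift_atSlopeCont _ hdrift hres hb hβ'

/-- **(U) alone, constant computed**: `BetaUpperH (d + 2A + s) γ₀ (betaOfRecord₁₃ F N θ)`. [cite: Balaban1987RG1, §1 p.264 and (5.10) p.293] -/
theorem betaUpperH_betaOfRecord₁₃_of_drift_atSlopeCont {d A γ₀ s : ℝ}
    (hdrift : letI := θ.instVβ₁; letI := θ.instVβ₂; letI := θ.instιβ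
      OneLoopDrift d A (beta0OfMerged (betaMerged F (mergedTermFamilyMatT F N (TcanOfRecord F N) (chiFixed29 F N θ.ν θ.ε₂₉) θ.εbg) θ.ρ8 θ.bV) θ.v₀))
    (hres : letI := θ.instVβ₁; letI := θ.instVβ₂; letI := θ.instιβ
      AtSlopeCont
        (oneLoopSplit_betaOfMerged (betaMerged F (mergedTermFamilyMatT F N (TcanOfRecord F N) (chiFixed29 F N θ.ν θ.ε₂₉) θ.εbg) θ.ρ8 θ.bV)
          (beta0OfMerged (betaMerged F (mergedTermFamilyMatT F N (TcanOfRecord F N) (chiFixed29 F N θ.ν θ.ε₂₉) θ.εbg) θ.ρ8 θ.bV) θ.v₀) θ.γ)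
        γ₀ s) :
    BetaUpperH (d + 2 * A + s) γ₀ (betaOfRecord₁₃ F N θ) :=
  betaUpperH_of_drift_atSlopeCont _ hdrift hres

/-- **(U) FROM A PINNED (D1) DATUM WITH ITS RESIDUE (stub 1's body at θ) + `AtSlopeCont` AT SLOPE `s`**: the pin reads the drift of `β⁰_θ` off the datum's step moments
(`Gaps.D1Residue.d1Drift_of_residue`, slope `stepBal Nc Lc`), so `∃ A ≥ 0, BetaUpperH (stepBal Nc Lc + 2A + s) γ₀ (betaOfRecord₁₃ F N θ)`.  Instance 0∕1.
[cite: Balaban1987RG1, (2.12)–(2.13) p.268, §1 p.264 and (5.10) p.293] -/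
theorem exists_betaUpperH_betaOfRecord₁₃_of_pin_residue_atSlopeCont {Lc : ℕ} [NeZero Lc] {Js : ℕ → JetData 3 Lc} {Nc γ₀ s : ℝ}
    (hβ : letI := θ.instVβ₁; letI := θ.instVβ₂; letI := θ.instιβ
      ∀ j, beta0OfMerged (betaMerged F (mergedTermFamilyMatT F N (TcanOfRecord F N) (chiFixed29 F N θ.ν θ.ε₂₉) θ.εbg) θ.ρ8 θ.bV) θ.v₀ j =
        secondMoment (TbalOf Lc Js j) 0 1)
    (hresd : Residue Lc Js Nc 0 1)
    (hres : letI := θ.instVβ₁; letI := θ.instVβ₂; letI := θ.instιβ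
      AtSlopeCont
        (oneLoopSplit_betaOfMerged (betaMerged F (mergedTermFamilyMatT F N (TcanOfRecord F N) (chiFixed29 F N θ.ν θ.ε₂₉) θ.εbg) θ.ρ8 θ.bV)
          (beta0OfMerged (betaMerged F (mergedTermFamilyMatT F N (TcanOfRecord F N) (chiFixed29 F N θ.ν θ.ε₂₉) θ.εbg) θ.ρ8 θ.bV) θ.v₀) θ.γ)
        γ₀ s) :
    ∃ A : ℝ, 0 ≤ A ∧ BetaUpperH (B12Normalization.stepBal Nc Lc + 2 * A + s) γ₀ (betaOfRecord₁₃ F N θ) := by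
  obtain ⟨A, hA⟩ := d1Drift_of_residue Js hresd
  have e : (fun j => secondMoment (TbalOf Lc Js j) 0 1) =
      (letI := θ.instVβ₁; letI := θ.instVβ₂; letI := θ.instιβ
       beta0OfMerged (betaMerged F (mergedTermFamilyMatT F N (TcanOfRecord F N) (chiFixed29 F N θ.ν θ.ε₂₉) θ.εbg) θ.ρ8 θ.bV) θ.v₀) :=
    funext fun j => (hβ j).symm
  rw [e] at hA
  exact ⟨A, hA.nonneg, betaUpperH_of_drift_atSlopeCont _ hA hres⟩

/-- **★ THE β-BOX, B4 AND (U) ON ONE BOX FROM THE JETS-FREE PAIR AT θ**: «`∃ d ≥ 0, A, OneLoopDrift d A β⁰_θ ∧ ∃ γ₀ ∈ ]0, θ.γ], AtSlopeCont (split₁₃ θ) γ₀ d`» (the right-hand side of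
dag-n26-c's `registeredPair₁₃_iff_jetsFreePair`) ⟹ `∃ γ₀ ∈ ]0, θ.γ], ∃ β′ ≥ 0, BetaUpperH β′ γ₀ β₁₃ ∧ BetaLowerH (−β′) γ₀ β₁₃ ∧ BetaContH γ₀ β₁₃`, `β₁₃ = betaOfRecord₁₃ F N θ`
(`β′ := 2d + 2A`; B4 by `betaContH_of_atSlopeCont`).  Instance 0∕1. [cite: Balaban1987RG1, Thm 2 p.259, §1 p.264, (2.12)–(2.14) p.268 and (5.10) p.293; Balaban1988RG2Cluster, Lemma 3 (2.38) p.20] -/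
theorem exists_betaBox_betaOfRecord₁₃_of_jetsFreePair
    (h : letI := θ.instVβ₁; letI := θ.instVβ₂; letI := θ.instιβ
      ∃ d A : ℝ, 0 ≤ d ∧
        OneLoopDrift d A (beta0OfMerged (betaMerged F (mergedTermFamilyMatT F N (TcanOfRecord F N) (chiFixed29 F N θ.ν θ.ε₂₉) θ.εbg) θ.ρ8 θ.bV) θ.v₀) ∧
        ∃ γ₀ : ℝ, 0 < γ₀ ∧ γ₀ ≤ θ.γ ∧
          AtSlopeCont
            (oneLoopSplit_betaOfMerged (betaMerged F (mergedTermFamilyMatT F N (TcanOfRecord F N) (chiFixed29 F N θ.ν θ.ε₂₉) θ.εbg) θ.ρ8 θ.bV)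
              (beta0OfMerged (betaMerged F (mergedTermFamilyMatT F N (TcanOfRecord F N) (chiFixed29 F N θ.ν θ.ε₂₉) θ.εbg) θ.ρ8 θ.bV) θ.v₀) θ.γ)
            γ₀ d) :
    ∃ γ₀ : ℝ, 0 < γ₀ ∧ γ₀ ≤ θ.γ ∧ ∃ β' : ℝ, 0 ≤ β' ∧
      BetaUpperH β' γ₀ (betaOfRecord₁₃ F N θ) ∧ BetaLowerH (-β') γ₀ (betaOfRecord₁₃ F N θ) ∧ BetaContH γ₀ (betaOfRecord₁₃ F N θ) := by
  obtain ⟨d, A, hd, hdrift, γ₀, hγ₀, hle, hres⟩ := h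
  have hA := hdrift.nonneg
  refine ⟨γ₀, hγ₀, hle, 2 * d + 2 * A, by positivity, ?_, ?_, betaContH_of_atSlopeCont hres⟩
  · exact fun k v hv => (betaUpperH_of_drift_atSlopeCont _ hdrift hres k v hv).trans (by linarith)
  · exact fun k v hv => le_trans (by linarith) (betaLowerH_of_drift_atSlopeCont _ hdrift hres k v hv)

/-- **★ THE SAME FROM THE TWO REGISTERED STUB BODIES AT θ, VERBATIM** («(∃ a pinned (D1) datum with its residue) ∧ (∀ such data, `∃ γ₀ ∈ ]0, θ.γ], AtSlopeCont (split₁₃ θ) γ₀ (stepBal Nc Lc)`)»,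
i.e. `D1AtRecord13` ∧ `D4AtSlopeOfD1Record13` read at `(F, N, θ)` without their proviso ∕ admissibility antecedents): (U), a two-sided bound and B4 on one box — through
`registeredPair₁₃_iff_jetsFreePair`.  So at every record where K2⁗'s stubs hold, the β-side row `(U)` of N24's `BetaBoundsInInterval` ∕ K2's top-runs criterion ∕ K0's β-box holds on
a box with SOME constant (its SIZE is the (D1)-letters number `2d + 2A`).  Instance 0∕1; neither stub proved. [cite: Balaban1987RG1, Thm 2 p.259, §1 p.264, (2.12)–(2.14) p.268 and (5.10) p.293; Balaban1988RG2Cluster, Lemma 3 (2.38) p.20] -/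
theorem exists_betaBox_betaOfRecord₁₃_of_registeredPair
    (h : letI := θ.instVβ₁; letI := θ.instVβ₂; letI := θ.instιβ
      (∃ (Lc : ℕ) (_ : NeZero Lc) (Js : ℕ → JetData 3 Lc) (Nc : ℝ),
        (∀ j, beta0OfMerged (betaMerged F (mergedTermFamilyMatT F N (TcanOfRecord F N) (chiFixed29 F N θ.ν θ.ε₂₉) θ.εbg) θ.ρ8 θ.bV) θ.v₀ j =
          secondMoment (TbalOf Lc Js j) 0 1) ∧
        Residue Lc Js Nc 0 1) ∧
      (∀ (Lc : ℕ) (_ : NeZero Lc) (Js : ℕ → JetData 3 Lc) (Nc : ℝ),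
        (∀ j, beta0OfMerged (betaMerged F (mergedTermFamilyMatT F N (TcanOfRecord F N) (chiFixed29 F N θ.ν θ.ε₂₉) θ.εbg) θ.ρ8 θ.bV) θ.v₀ j =
            secondMoment (TbalOf Lc Js j) 0 1) →
        Residue Lc Js Nc 0 1 →
        ∃ γ₀ : ℝ, 0 < γ₀ ∧ γ₀ ≤ θ.γ ∧
          AtSlopeCont
            (oneLoopSplit_betaOfMerged (betaMerged F (mergedTermFamilyMatT F N (TcanOfRecord F N) (chiFixed29 F N θ.ν θ.ε₂₉) θ.εbg) θ.ρ8 θ.bV)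
              (beta0OfMerged (betaMerged F (mergedTermFamilyMatT F N (TcanOfRecord F N) (chiFixed29 F N θ.ν θ.ε₂₉) θ.εbg) θ.ρ8 θ.bV) θ.v₀) θ.γ)
            γ₀ (B12Normalization.stepBal Nc Lc))) :
    ∃ γ₀ : ℝ, 0 < γ₀ ∧ γ₀ ≤ θ.γ ∧ ∃ β' : ℝ, 0 ≤ β' ∧
      BetaUpperH β' γ₀ (betaOfRecord₁₃ F N θ) ∧ BetaLowerH (-β') γ₀ (betaOfRecord₁₃ F N θ) ∧ BetaContH γ₀ (betaOfRecord₁₃ F N θ) :=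
  exists_betaBox_betaOfRecord₁₃_of_jetsFreePair F N θ ((registeredPair₁₃_iff_jetsFreePair F N θ).1 h)

end AtRecord

/-! ## §2 At NODE 00's C¹ witness `θ₁₅ᶜᶜ¹` on the box `½ = θ₁₅ᶜᶜ¹.γ`: K0a FILE 14d's β-box binders from the K2 pair's letters -/

section AtThetaCC1

variable (ε₀ ε₂₉ B₃ B₃' a₀ a₁ : ℝ)

/-- **★ K0's β-BOX LEAF AT `θ₁₅ᶜᶜ¹` ON `]0, ½]` FROM THE K2 PAIR's LETTERS**: the drift `(d, A)` of `β⁰(θ₁₅ᶜᶜ¹)` and `AtSlopeCont (split₁₃ θ₁₅ᶜᶜ¹) (1∕2) s` (the largest box the (D4) road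
serves there: `θ₁₅ᶜᶜ¹.γ = ½`, K0a `theta13OfThm1CC1_γ`) give `BetaLowerH b (1∕2) (betaOfRecord₁₃ F N θ₁₅ᶜᶜ¹) ∧ BetaUpperH β′ (1∕2) (betaOfRecord₁₃ F N θ₁₅ᶜᶜ¹)` whenever `b ≤ d − 2A − s` and
`d + 2A + s ≤ β′` — the two binders `hlow ∕ hup` of node00-def-K0a's `hcompRev_theta13OfThm1CC1_of_betaBox` BY NAME; its letter `β′ ≤ 3` becomes the (D1)-letters inequality
`d + 2A + s ≤ 3`, its `0 ≤ b` the inequality `2A + s ≤ d` (NOT supplied here).  Instance 0∕1. [cite: Balaban1987RG1, §1 p.264, (2.12)–(2.14) p.268 and (5.10) p.293; Balaban1988Convergent, (2.6)–(2.9) p.255] -/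
theorem betaBox_half_theta13OfThm1CC1_of_drift_atSlopeCont {d A s b β' : ℝ}
    (hdrift : letI := (theta13OfThm1CC1 F N ε₀ ε₂₉ B₃ B₃' a₀ a₁).instVβ₁; letI := (theta13OfThm1CC1 F N ε₀ ε₂₉ B₃ B₃' a₀ a₁).instVβ₂
      letI := (theta13OfThm1CC1 F N ε₀ ε₂₉ B₃ B₃' a₀ a₁).instιβ
      OneLoopDrift d A
        (beta0OfMerged (betaMerged F (mergedTermFamilyMatT F N (TcanOfRecord F N)
          (chiFixed29 F N (theta13OfThm1CC1 F N ε₀ ε₂₉ B₃ B₃' a₀ a₁).ν (theta13OfThm1CC1 F N ε₀ ε₂₉ B₃ B₃' a₀ a₁).ε₂₉)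
          (theta13OfThm1CC1 F N ε₀ ε₂₉ B₃ B₃' a₀ a₁).εbg) (theta13OfThm1CC1 F N ε₀ ε₂₉ B₃ B₃' a₀ a₁).ρ8 (theta13OfThm1CC1 F N ε₀ ε₂₉ B₃ B₃' a₀ a₁).bV)
          (theta13OfThm1CC1 F N ε₀ ε₂₉ B₃ B₃' a₀ a₁).v₀))
    (hres : letI := (theta13OfThm1CC1 F N ε₀ ε₂₉ B₃ B₃' a₀ a₁).instVβ₁; letI := (theta13OfThm1CC1 F N ε₀ ε₂₉ B₃ B₃' a₀ a₁).instVβ₂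
      letI := (theta13OfThm1CC1 F N ε₀ ε₂₉ B₃ B₃' a₀ a₁).instιβ
      AtSlopeCont
        (oneLoopSplit_betaOfMerged
          (betaMerged F (mergedTermFamilyMatT F N (TcanOfRecord F N)
            (chiFixed29 F N (theta13OfThm1CC1 F N ε₀ ε₂₉ B₃ B₃' a₀ a₁).ν (theta13OfThm1CC1 F N ε₀ ε₂₉ B₃ B₃' a₀ a₁).ε₂₉)
            (theta13OfThm1CC1 F N ε₀ ε₂₉ B₃ B₃' a₀ a₁).εbg) (theta13OfThm1CC1 F N ε₀ ε₂₉ B₃ B₃' a₀ a₁).ρ8 (theta13OfThm1CC1 F N ε₀ ε₂₉ B₃ B₃' a₀ a₁).bV)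
          (beta0OfMerged (betaMerged F (mergedTermFamilyMatT F N (TcanOfRecord F N)
            (chiFixed29 F N (theta13OfThm1CC1 F N ε₀ ε₂₉ B₃ B₃' a₀ a₁).ν (theta13OfThm1CC1 F N ε₀ ε₂₉ B₃ B₃' a₀ a₁).ε₂₉)
            (theta13OfThm1CC1 F N ε₀ ε₂₉ B₃ B₃' a₀ a₁).εbg) (theta13OfThm1CC1 F N ε₀ ε₂₉ B₃ B₃' a₀ a₁).ρ8 (theta13OfThm1CC1 F N ε₀ ε₂₉ B₃ B₃' a₀ a₁).bV)
            (theta13OfThm1CC1 F N ε₀ ε₂₉ B₃ B₃' a₀ a₁).v₀)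
          (theta13OfThm1CC1 F N ε₀ ε₂₉ B₃ B₃' a₀ a₁).γ)
        (1 / 2) s)
    (hb : b ≤ d - 2 * A - s) (hβ' : d + 2 * A + s ≤ β') :
    BetaLowerH b (1 / 2) (betaOfRecord₁₃ F N (theta13OfThm1CC1 F N ε₀ ε₂₉ B₃ B₃' a₀ a₁)) ∧
      BetaUpperH β' (1 / 2) (betaOfRecord₁₃ F N (theta13OfThm1CC1 F N ε₀ ε₂₉ B₃ B₃' a₀ a₁)) :=
  betaBox_betaOfRecord₁₃_of_drift_atSlopeCont F N (theta13OfThm1CC1 F N ε₀ ε₂₉ B₃ B₃' a₀ a₁) hdrift hres hb hβ'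

/-- **(U) at `θ₁₅ᶜᶜ¹` on `]0, ½]` from a PINNED (D1) datum + `AtSlopeCont` at slope `s`** (§1 at the witness): `∃ A ≥ 0, BetaUpperH (stepBal Nc Lc + 2A + s) (1∕2) (betaOfRecord₁₃ F N θ₁₅ᶜᶜ¹)`.
Instance 0∕1. [cite: Balaban1987RG1, (2.12)–(2.13) p.268, §1 p.264 and (5.10) p.293] -/
theorem exists_betaUpperH_half_theta13OfThm1CC1_of_pin_residue_atSlopeCont {Lc : ℕ} [NeZero Lc] {Js : ℕ → JetData 3 Lc} {Nc s : ℝ}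
    (hβ : letI := (theta13OfThm1CC1 F N ε₀ ε₂₉ B₃ B₃' a₀ a₁).instVβ₁; letI := (theta13OfThm1CC1 F N ε₀ ε₂₉ B₃ B₃' a₀ a₁).instVβ₂
      letI := (theta13OfThm1CC1 F N ε₀ ε₂₉ B₃ B₃' a₀ a₁).instιβ
      ∀ j, beta0OfMerged (betaMerged F (mergedTermFamilyMatT F N (TcanOfRecord F N)
          (chiFixed29 F N (theta13OfThm1CC1 F N ε₀ ε₂₉ B₃ B₃' a₀ a₁).ν (theta13OfThm1CC1 F N ε₀ ε₂₉ B₃ B₃' a₀ a₁).ε₂₉)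
          (theta13OfThm1CC1 F N ε₀ ε₂₉ B₃ B₃' a₀ a₁).εbg) (theta13OfThm1CC1 F N ε₀ ε₂₉ B₃ B₃' a₀ a₁).ρ8 (theta13OfThm1CC1 F N ε₀ ε₂₉ B₃ B₃' a₀ a₁).bV)
          (theta13OfThm1CC1 F N ε₀ ε₂₉ B₃ B₃' a₀ a₁).v₀ j =
        secondMoment (TbalOf Lc Js j) 0 1)
    (hresd : Residue Lc Js Nc 0 1)
    (hres : letI := (theta13OfThm1CC1 F N ε₀ ε₂₉ B₃ B₃' a₀ a₁).instVβ₁; letI := (theta13OfThm1CC1 F N ε₀ ε₂₉ B₃ B₃' a₀ a₁).instVβ₂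
      letI := (theta13OfThm1CC1 F N ε₀ ε₂₉ B₃ B₃' a₀ a₁).instιβ
      AtSlopeCont
        (oneLoopSplit_betaOfMerged
          (betaMerged F (mergedTermFamilyMatT F N (TcanOfRecord F N)
            (chiFixed29 F N (theta13OfThm1CC1 F N ε₀ ε₂₉ B₃ B₃' a₀ a₁).ν (theta13OfThm1CC1 F N ε₀ ε₂₉ B₃ B₃' a₀ a₁).ε₂₉)
            (theta13OfThm1CC1 F N ε₀ ε₂₉ B₃ B₃' a₀ a₁).εbg) (theta13OfThm1CC1 F N ε₀ ε₂₉ B₃ B₃' a₀ a₁).ρ8 (theta13OfThm1CC1 F N ε₀ ε₂₉ B₃ B₃' a₀ a₁).bV)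
          (beta0OfMerged (betaMerged F (mergedTermFamilyMatT F N (TcanOfRecord F N)
            (chiFixed29 F N (theta13OfThm1CC1 F N ε₀ ε₂₉ B₃ B₃' a₀ a₁).ν (theta13OfThm1CC1 F N ε₀ ε₂₉ B₃ B₃' a₀ a₁).ε₂₉)
            (theta13OfThm1CC1 F N ε₀ ε₂₉ B₃ B₃' a₀ a₁).εbg) (theta13OfThm1CC1 F N ε₀ ε₂₉ B₃ B₃' a₀ a₁).ρ8 (theta13OfThm1CC1 F N ε₀ ε₂₉ B₃ B₃' a₀ a₁).bV)
            (theta13OfThm1CC1 F N ε₀ ε₂₉ B₃ B₃' a₀ a₁).v₀)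
          (theta13OfThm1CC1 F N ε₀ ε₂₉ B₃ B₃' a₀ a₁).γ)
        (1 / 2) s) :
    ∃ A : ℝ, 0 ≤ A ∧ BetaUpperH (B12Normalization.stepBal Nc Lc + 2 * A + s) (1 / 2) (betaOfRecord₁₃ F N (theta13OfThm1CC1 F N ε₀ ε₂₉ B₃ B₃' a₀ a₁)) :=
  exists_betaUpperH_betaOfRecord₁₃_of_pin_residue_atSlopeCont F N (theta13OfThm1CC1 F N ε₀ ε₂₉ B₃ B₃' a₀ a₁) hβ hresd hres

end AtThetaCC1

end Summit.QuantumFields.YangMills.Theorems.BalabanUVNodesN26AtRecord13BetaBoxOfDriftAtSlope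

end
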